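import Literature.NumberTheory.LFunctions.YoshidaWindowGramColumnData
import HarnessLib

/-!
# Format C, kit `CBM`: two list-plumbing facts for the generated rung files

Helper file of the rh-explicit Weil-positivity programme (`--supports stmt-RiemannHypothesis-0098`; seat
rh-explicit-weil-2 gen7), RH-free, no definitions, no named facts.  The `CBM` kit certifies ONE reciprocal dyadic
weight list `v` over `[B, B₄)` (exact columns AND compressed middle) while the Schur bands use its length-`K` prefix
and the middle moments (part XI-b) read the middle weights as `wvF (v.drop K) cv B₃`, `B₃ = B + K`:

* `wvF_drop` — `wvF (v.drop K) cv (B + K) m = wvF v cv B m` for `B + K ≤ m`;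
* `usubCB_congr_weights` — `usubCB` only reads the first `K` weights.
-/

set_option linter.dupNamespace false
set_option autoImplicit false

noncomputable section

namespace Summit.RiemannHypothesis.RiemannHypothesis.Theorems.WeilFormatC

open Literature.NumberTheory.LFunctions.Yoshida1992.Encl

/-- The middle weights read from the tail of the list are the kit's weights. -/
theorem wvF_drop (v : List ℕ) (cv B K : ℕ) {m : ℕ} (hm : B + K ≤ m) :
    wvF (v.drop K) cv (B + K) m = wvF v cv B m := by
  unfold wvF
  simp only [List.getD_eq_getElem?_getD, List.getElem?_drop]
  rw [show K + (m - (B + K)) = m - B by omega]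

/-- `usubCB` depends on the weight list only through its first `K` entries. -/
theorem usubCB_congr_weights (M φ ψ : ℕ → ℕ → ℝ) (dg : ℕ → ℝ) (B K cv : ℕ) {v v' : List ℕ} (R2 : ℕ)
    (h : ∀ t < K, v.getD t 0 = v'.getD t 0) (i j : ℕ) :
    usubCB M φ ψ dg B K cv v R2 i j = usubCB M φ ψ dg B K cv v' R2 i j := by
  unfold usubCB
  congr 1; congr 1
  exact Finset.sum_congr rfl fun t ht ↦ by rw [h t (Finset.mem_range.mp ht)]

/-- The prefix read off `List.take`. -/
theorem getD_eq_of_take_eq {v v' : List ℕ} {K : ℕ} (hv : v'.take K = v) {t : ℕ} (ht : t < K) :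
    v.getD t 0 = v'.getD t 0 := by
  subst hv
  simp only [List.getD_eq_getElem?_getD, List.getElem?_take, if_pos ht]

end Summit.RiemannHypothesis.RiemannHypothesis.Theorems.WeilFormatC

end
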